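import Literature.Probability.RandomPlanarGeometry.HexSAWBrickWallSlab
import Literature.Probability.RandomPlanarGeometry.HexSAWBrickWallStripCuts
import HarnessLib

/-!
# Row slabCuts of a self-avoiding walk in a column slab of the brick wall: at least `⌊n/(H+1)⌋` slabCuts, and at least
# `⌊n/(2(H+1))⌋` parity-admissible ones

Topic `Literature/Probability/RandomPlanarGeometry` (the coordinate-0 twin of `HexSAWBrickWallStripCuts.lean`; continues
`HexSAWBrickWallSlab.lean` — the column slabs `Slab_H = {0,…,H} × ℤ` and their walks `HexBW.slabPairs H n`).
Source of the statement shape: N. Madras, G. Slade, *The Self-Avoiding Walk* (1993), §8.2, Theorem 8.2.1 (8.2.13) (strict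
monotonicity of `μ(R[k,T])` in `T`, by insertion at the slabCuts of the walk; margin = density of usable slabCuts × `log(1 + μ^{-cost})`).
For the column slabs the insertion of the lane «pcv-sawmu» door R100 «HEX-ARMCHAIR-SLAB-SUBCRIT» (a-p5 g7 design: two new ROWS at
the slabCuts `x₁ = r + ½` with `r + H` EVEN, "parity-admissible") needs the number of admissible row slabCuts — this file.

## Contents (namespace `Literature.Probability.RandomPlanarGeometry.SAW.HexBW`, all PROVED)

* `slabCuts a ω n` — the rows `r` such that some step `t < n` of the placed walk crosses the line `x₁ = r + ½` (a vertical
  brick-wall step between the rows `r` and `r + 1`); `admissibleSlabCuts H a ω n` — those with `r + H` even; `rows a ω n` — the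
  visited ordinates;
* `mem_slabCuts_of_le_of_lt`, `Ico_subset_slabCuts` (every row between the lowest and the highest visited one, the latter
  excluded, is a cut); `succ_le_card_rows_mul` — pigeonhole `n + 1 ≤ #rows · (H+1)`;
* **`div_le_card_slabCuts`** — `n / (H+1) ≤ #slabCuts`; **`div_le_card_admissibleSlabCuts`** — `n / (2(H+1)) ≤ #admissibleSlabCuts`.
-/

noncomputable section

open Finset Literature.Probability.LatticeModels Literature.Probability.Percolation SimpleGraph

namespace Literature.Probability.RandomPlanarGeometry.SAW.HexBW

/-- Consecutive ordinates of a brick-wall walk differ by at most one. [cite: EntingJensen2009, §7.4.2, Fig. 7.10 (brickwork form of the honeycomb lattice)] -/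
theorem abs_sub_apply_one_le_one {x y : Site 2} (h : brickWallGraph.Adj x y) : |y 1 - x 1| ≤ 1 := by
  rw [brickWallGraph_adj_coord] at h
  rw [abs_le]
  omega

/-! ### Discrete intermediate values -/

/-- Discrete intermediate value property (upwards) for an integer sequence with increments `≤ 1`.
[cite: MadrasSlade1993, §8.2, Theorem 8.2.1 (8.2.13) (slabCuts of a slab walk)] -/
private theorem exists_cross_up {f : ℕ → ℤ} {v : ℤ} :
    ∀ b a : ℕ, (∀ t < b, f (t + 1) ≤ f t + 1) → a < b → f a ≤ v → v < f b →
      ∃ t < b, f t = v ∧ f (t + 1) = v + 1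
  | 0, a, _, hab, _, _ => absurd hab (Nat.not_lt_zero a)
  | b + 1, a, hf, hab, ha, hb => by
    by_cases h : f b ≤ v
    · have := hf b (Nat.lt_succ_self b)
      exact ⟨b, Nat.lt_succ_self b, by omega, by omega⟩
    · have hab' : a < b := by
        rcases Nat.lt_succ_iff_lt_or_eq.1 hab with h' | rfl
        · exact h'
        · exact absurd ha h
      obtain ⟨t, ht, h1, h2⟩ :=
        exists_cross_up b a (fun t ht => hf t (by omega)) hab' ha (by omega)
      exact ⟨t, by omega, h1, h2⟩

/-- Discrete intermediate value property (downwards) for an integer sequence with decrements `≤ 1`.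
[cite: MadrasSlade1993, §8.2, Theorem 8.2.1 (8.2.13) (slabCuts of a slab walk)] -/
private theorem exists_cross_down {f : ℕ → ℤ} {v : ℤ} :
    ∀ b a : ℕ, (∀ t < b, f t ≤ f (t + 1) + 1) → a < b → v < f a → f b ≤ v →
      ∃ t < b, f t = v + 1 ∧ f (t + 1) = v
  | 0, a, _, hab, _, _ => absurd hab (Nat.not_lt_zero a)
  | b + 1, a, hf, hab, ha, hb => by
    by_cases h : v < f b
    · have := hf b (Nat.lt_succ_self b)
      exact ⟨b, Nat.lt_succ_self b, by omega, by omega⟩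
    · have hab' : a < b := by
        rcases Nat.lt_succ_iff_lt_or_eq.1 hab with h' | rfl
        · exact h'
        · exact absurd ha h
      obtain ⟨t, ht, h1, h2⟩ :=
        exists_cross_down b a (fun t ht => hf t (by omega)) hab' ha (by omega)
      exact ⟨t, by omega, h1, h2⟩

/-! ### SlabCuts, admissible slabCuts, visited columns -/

/-- The column slabCuts of the placed walk `t ↦ a + ω t` up to time `n`: the `c ∈ ℤ` such that some step crosses the line
`x = c + ½` (a horizontal brick-wall step between the abscissae `c` and `c + 1`, in either direction).
[cite: MadrasSlade1993, §8.2, Theorem 8.2.1 (8.2.13) (column slabCuts)] -/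
def slabCuts (a : Site 2) (ω : ℕ → Site 2) (n : ℕ) : Finset ℤ :=
  ((Finset.range n).filter fun t => (a + ω t) 1 ≠ (a + ω (t + 1)) 1).image
    fun t => min ((a + ω t) 1) ((a + ω (t + 1)) 1)

/-- The PARITY-ADMISSIBLE row slabCuts of the slab `Slab_H`: the slabCuts `c` with `c + H` even (the places where the double-row
insertion of the door «HEX-ARMCHAIR-SLAB-SUBCRIT» can be performed). [cite: MadrasSlade1993, §8.2, Theorem 8.2.1 (8.2.13)] -/
def admissibleSlabCuts (H : ℕ) (a : Site 2) (ω : ℕ → Site 2) (n : ℕ) : Finset ℤ :=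
  (slabCuts a ω n).filter fun c : ℤ => (c + (H : ℤ)) % 2 = 0

/-- The visited abscissae of the placed walk up to time `n`. [cite: MadrasSlade1993, §8.2] -/
def rows (a : Site 2) (ω : ℕ → Site 2) (n : ℕ) : Finset ℤ := (Finset.range (n + 1)).image fun t => (a + ω t) 1

/-- Membership in `slabCuts`. [cite: MadrasSlade1993, §8.2, Theorem 8.2.1 (8.2.13)] -/
theorem mem_slabCuts {a : Site 2} {ω : ℕ → Site 2} {n : ℕ} {c : ℤ} :
    c ∈ slabCuts a ω n ↔ ∃ t < n, (a + ω t) 1 ≠ (a + ω (t + 1)) 1 ∧ min ((a + ω t) 1) ((a + ω (t + 1)) 1) = c := by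
  simp only [slabCuts, mem_image, mem_filter, mem_range]
  constructor
  · rintro ⟨t, ⟨ht, hne⟩, hc⟩; exact ⟨t, ht, hne, hc⟩
  · rintro ⟨t, ht, hne, hc⟩; exact ⟨t, ⟨ht, hne⟩, hc⟩

/-- Membership in `admissibleSlabCuts`. [cite: MadrasSlade1993, §8.2, Theorem 8.2.1 (8.2.13)] -/
theorem mem_admissibleSlabCuts {H : ℕ} {a : Site 2} {ω : ℕ → Site 2} {n : ℕ} {c : ℤ} :
    c ∈ admissibleSlabCuts H a ω n ↔ c ∈ slabCuts a ω n ∧ (c + (H : ℤ)) % 2 = 0 := mem_filter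

/-- `#admissibleSlabCuts ≤ #slabCuts ≤ n`. [cite: MadrasSlade1993, §8.2] -/
theorem card_slabCuts_le (a : Site 2) (ω : ℕ → Site 2) (n : ℕ) : (slabCuts a ω n).card ≤ n :=
  (card_image_le.trans (card_filter_le _ _)).trans (by rw [card_range])

section SlabWalk

variable {H n : ℕ} {a : Site 2} {ω : ℕ → Site 2}

/-- Consecutive abscissae of a brick-wall walk differ by at most one. [cite: EntingJensen2009, §7.4.2, Fig. 7.10 (brickwork form of the honeycomb lattice)] -/
theorem row_step (hp : (a, ω) ∈ slabPairs H n) {t : ℕ} (ht : t < n) :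
    (a + ω (t + 1)) 1 ≤ (a + ω t) 1 + 1 ∧ (a + ω t) 1 ≤ (a + ω (t + 1)) 1 + 1 := by
  obtain ⟨-, -, hbw, -⟩ := mem_slabPairs.1 hp
  dsimp only at hbw
  have h := abs_sub_apply_one_le_one (hbw t ht)
  rw [abs_le] at h
  constructor <;> linarith [h.1, h.2]

/-- **Every column weakly right of one visited abscissa and strictly left of another is a cut** (discrete
intermediate values along the walk, in the direction of time that applies). [cite: MadrasSlade1993, §8.2, Theorem 8.2.1 (8.2.13)] -/
theorem mem_slabCuts_of_le_of_lt (hp : (a, ω) ∈ slabPairs H n) {s s' : ℕ} (hs : s ≤ n) (hs' : s' ≤ n) {c : ℤ}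
    (h1 : (a + ω s) 1 ≤ c) (h2 : c < (a + ω s') 1) : c ∈ slabCuts a ω n := by
  have hne : s ≠ s' := by rintro rfl; omega
  rcases lt_or_gt_of_ne hne with hlt | hgt
  · obtain ⟨t, ht, e1, e2⟩ := exists_cross_up (f := fun t => (a + ω t) 1) s' s
      (fun t ht => (row_step hp (by omega)).1) hlt h1 h2
    exact mem_slabCuts.2 ⟨t, by omega, by omega, by rw [e1, e2]; simp⟩
  · obtain ⟨t, ht, e1, e2⟩ := exists_cross_down (f := fun t => (a + ω t) 1) s s'
      (fun t ht => (row_step hp (by omega)).2) hgt h2 h1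
    exact mem_slabCuts.2 ⟨t, by omega, by omega, by rw [e1, e2]; simp⟩

/-- The columns visited form a nonempty set. [cite: MadrasSlade1993, §8.2] -/
theorem rows_nonempty (a : Site 2) (ω : ℕ → Site 2) (n : ℕ) : (rows a ω n).Nonempty :=
  ⟨(a + ω 0) 1, mem_image.2 ⟨0, by simp, rfl⟩⟩

/-- **Every column from the leftmost visited one (included) to the rightmost (excluded) is a cut.**
[cite: MadrasSlade1993, §8.2, Theorem 8.2.1 (8.2.13)] -/
theorem Ico_subset_slabCuts (hp : (a, ω) ∈ slabPairs H n) :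
    Finset.Ico ((rows a ω n).min' (rows_nonempty a ω n)) ((rows a ω n).max' (rows_nonempty a ω n)) ⊆ slabCuts a ω n := by
  intro c hc
  rw [Finset.mem_Ico] at hc
  obtain ⟨s, hs, hse⟩ := mem_image.1 (Finset.min'_mem _ (rows_nonempty a ω n))
  obtain ⟨s', hs', hs'e⟩ := mem_image.1 (Finset.max'_mem _ (rows_nonempty a ω n))
  have hsn : s ≤ n := by simpa [Nat.lt_succ_iff] using hs
  have hs'n : s' ≤ n := by simpa [Nat.lt_succ_iff] using hs'
  exact mem_slabCuts_of_le_of_lt hp hsn hs'n (by rw [hse]; exact hc.1) (by rw [hs'e]; exact hc.2)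

/-- The visited columns lie between the leftmost and the rightmost one: `#rows ≤ max − min + 1`.
[cite: MadrasSlade1993, §8.2] -/
theorem card_rows_le (a : Site 2) (ω : ℕ → Site 2) (n : ℕ) :
    ((rows a ω n).card : ℤ) ≤
      (rows a ω n).max' (rows_nonempty a ω n) - (rows a ω n).min' (rows_nonempty a ω n) + 1 := by
  have hsub : rows a ω n ⊆ Finset.Icc ((rows a ω n).min' (rows_nonempty a ω n))
      ((rows a ω n).max' (rows_nonempty a ω n)) := fun c hc =>
    Finset.mem_Icc.2 ⟨Finset.min'_le _ _ hc, Finset.le_max' _ _ hc⟩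
  have h := Finset.card_le_card hsub
  rw [Int.card_Icc] at h
  have : (((rows a ω n).max' (rows_nonempty a ω n) + 1 - (rows a ω n).min' (rows_nonempty a ω n)).toNat : ℤ) =
      (rows a ω n).max' (rows_nonempty a ω n) + 1 - (rows a ω n).min' (rows_nonempty a ω n) :=
    Int.toNat_of_nonneg (by linarith [Finset.min'_le (rows a ω n) _ (Finset.max'_mem _ (rows_nonempty a ω n))])
  have h' : ((rows a ω n).card : ℤ) ≤ (((rows a ω n).max' (rows_nonempty a ω n) + 1 -
      (rows a ω n).min' (rows_nonempty a ω n)).toNat : ℤ) := by exact_mod_cast h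
  linarith

/-- **Pigeonhole**: the `n + 1` distinct sites of the walk lie in `#rows` columns of `H + 1` sites each:
`n + 1 ≤ #rows · (H+1)`. [cite: MadrasSlade1993, §8.2, Theorem 8.2.1 (8.2.13)] -/
theorem succ_le_card_rows_mul (hp : (a, ω) ∈ slabPairs H n) : n + 1 ≤ (rows a ω n).card * (H + 1) := by
  obtain ⟨-, hω, -, hR⟩ := mem_slabPairs.1 hp
  dsimp only at hω hR
  obtain ⟨-, -, -, hinj⟩ := Zd.mem_saws.1 hω
  have h := Finset.card_le_card_of_injOn (s := Finset.range (n + 1)) (t := rows a ω n ×ˢ Finset.range (H + 1))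
    (fun t => ((a + ω t) 1, ((a + ω t) 0).toNat)) (fun t ht => ?_) (fun t ht t' ht' h => ?_)
  · simpa using h
  · have ht' : t ≤ n := by simpa [Nat.lt_succ_iff] using ht
    simp only [Finset.coe_product, Finset.coe_range, Set.mem_prod, Finset.mem_coe, Set.mem_Iio]
    refine ⟨mem_image.2 ⟨t, by simpa using ht, rfl⟩, ?_⟩
    have h1 := (hR t ht').1; have h2 := (hR t ht').2; omega
  · have htn : t ≤ n := by simpa [Nat.lt_succ_iff] using ht
    have htn' : t' ≤ n := by simpa [Nat.lt_succ_iff] using ht'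
    simp only [Prod.mk.injEq] at h
    have h0 := (hR t htn).1; have h0' := (hR t' htn').1
    have e1 : (a + ω t) 0 = (a + ω t') 0 := by omega
    have e : ω t = ω t' := by
      have ha : a + ω t = a + ω t' := by
        funext i; fin_cases i
        · exact e1
        · exact h.1
      exact add_left_cancel ha
    exact hinj htn htn' e

/-- **Every `n`-step walk of the slab `Slab_H` has at least `n / (H+1)` row slabCuts.**
[cite: MadrasSlade1993, §8.2, Theorem 8.2.1 (8.2.13)] -/
theorem div_le_card_slabCuts (hp : (a, ω) ∈ slabPairs H n) : n / (H + 1) ≤ (slabCuts a ω n).card := by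
  have h1 := Finset.card_le_card (Ico_subset_slabCuts hp)
  rw [Int.card_Ico] at h1
  have h2 := card_rows_le a ω n
  have h3 := succ_le_card_rows_mul hp
  have h4 : n / (H + 1) < (rows a ω n).card := by
    by_contra h
    have : (rows a ω n).card * (H + 1) ≤ n / (H + 1) * (H + 1) := Nat.mul_le_mul_right _ (not_lt.1 h)
    have h5 : n / (H + 1) * (H + 1) ≤ n := Nat.div_mul_le_self n (H + 1)
    omega
  have h6 : ((rows a ω n).card : ℤ) - 1 ≤
      (((rows a ω n).max' (rows_nonempty a ω n) - (rows a ω n).min' (rows_nonempty a ω n)).toNat : ℤ) := by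
    have := Int.self_le_toNat ((rows a ω n).max' (rows_nonempty a ω n) - (rows a ω n).min' (rows_nonempty a ω n))
    linarith
  have h7 : (rows a ω n).card - 1 ≤ (slabCuts a ω n).card := by
    have : ((rows a ω n).card : ℤ) - 1 ≤ ((slabCuts a ω n).card : ℤ) := h6.trans (by exact_mod_cast h1)
    omega
  omega

/-! ### Parity-admissible slabCuts -/

/-- **Every `n`-step walk of `Slab_H` has at least `n / (2(H+1))` parity-admissible row slabCuts.**
[cite: MadrasSlade1993, §8.2, Theorem 8.2.1 (8.2.13)] -/
theorem div_le_card_admissibleSlabCuts (hp : (a, ω) ∈ slabPairs H n) :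
    n / (2 * (H + 1)) ≤ (admissibleSlabCuts H a ω n).card := by
  classical
  set m := (rows a ω n).min' (rows_nonempty a ω n) with hm
  set M := (rows a ω n).max' (rows_nonempty a ω n) with hM
  -- admissible slabCuts ⊇ the odd-parity columns of `[m, M)`
  have hsub : ((Finset.Ico m M).filter fun c : ℤ => (c + ((H + 1 : ℕ) : ℤ)) % 2 = 1) ⊆ admissibleSlabCuts H a ω n := by
    intro c hc
    rw [mem_filter] at hc
    exact mem_admissibleSlabCuts.2 ⟨Ico_subset_slabCuts hp hc.1, by push_cast at hc; omega⟩
  have h1 := (card_filter_odd_Ico_ge (H + 1) m M).trans (Finset.card_le_card hsub)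
  -- `#rows - 1 ≤ M - m` and `n/(H+1) < #rows`
  have h2 := card_rows_le a ω n
  have h3 := succ_le_card_rows_mul hp
  have h4 : n / (H + 1) < (rows a ω n).card := by
    by_contra h
    have : (rows a ω n).card * (H + 1) ≤ n / (H + 1) * (H + 1) := Nat.mul_le_mul_right _ (not_lt.1 h)
    have h5 : n / (H + 1) * (H + 1) ≤ n := Nat.div_mul_le_self n (H + 1)
    omega
  have h6 : (rows a ω n).card - 1 ≤ (M - m).toNat := by
    have := Int.self_le_toNat (M - m)
    have h2' : ((rows a ω n).card : ℤ) ≤ M - m + 1 := h2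
    omega
  have h7 : n / (2 * (H + 1)) = n / (H + 1) / 2 := by rw [Nat.div_div_eq_div_mul, mul_comm]
  rw [h7]
  calc n / (H + 1) / 2 ≤ ((rows a ω n).card - 1) / 2 := Nat.div_le_div_right (by omega)
    _ ≤ (M - m).toNat / 2 := Nat.div_le_div_right h6
    _ ≤ _ := h1

end SlabWalk

end Literature.Probability.RandomPlanarGeometry.SAW.HexBW
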